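import Mathlib
import Summits.MatrixMultiplication.MatrixMultiplication.Theorems.LieRankDesigns.Negative.Basics
import Literature.Barriers.MatrixMultiplication.NormalizerBarrier
import HarnessLib.Audit

/-!
# Line `subgroup-hosts-one-function` — crux `LevelGradedCohnUmans.LieRankDesigns` (stmt-MatrixMultiplication-7614)

Skeleton (crux-plan, round 1, planner `planner-cruxplan-stmt-MatrixMultiplication-7614-subgroup-hosts-one-f-0`,
2026-08-16) of the idea card `Cruxes/LieRankDesigns/Ideas/subgroup-hosts-one-function.md` (ideator 1), triage
`TRIAGE-r1-1.md` / `-2.md` / `-3.md`: pass × 3 with sharpenings (Neumann-corrected hosts = index-`≥ 2` subgroups of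
`N⁻_W ⋊ GL_{k/2}²` or `⋊ GL_{k/2}(𝔽_{p²})`; `U_k·T_{k/2}` and `P_{(a,k−a)}(𝔽_{p³})` dead; mutual general position
with `ν = O(1)`; condition (b) of r1-2 App. B as the first pre-test).

CRUX (by name): `Summit.MatrixMultiplication.MatrixMultiplication.Theses.LevelGradedCohnUmans.LieRankDesigns` —
`∀ ε > 0 ∃ p prime, m, k, X Y Z ⊆ GL_m(𝔽_p)` rank-`≤ k`-separated (`RankSep`) with
`budget p m k (2+ε) < volume X Y Z ^ ((2+ε)/3)` (vocabulary of `Theorems/LieRankDesigns/Negative/Basics.lean`;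
`lieRankDesigns_iff` is `Iff.rfl`).

THE LINE (subgroup hosts + one function).  Below the wall the graded price re-admits SUBGROUP triples, and for
subgroups the `|X||Z|` separation conditions collapse to ONE identity test (route item `SubgroupIdentityLink`,
PROVED; re-proved here for conjugate triples as `rankSep_of_hosts`).  Hosts: three conjugates
`(H, H^{g₂}, H^{g₃})` of ONE explicit group of the wall dimension `e = nk − k²/2`,
  `H = {g ∈ GL_n(𝔽_p) : g e_j = e_j (j ≥ k), g|_{⟨e_1..e_k⟩} = diag(A₁, A₂) ∈ GL_{k/2} × GL_{k/2}, det A₁ ∈ (𝔽_p^×)²}`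
`= N⁻_W ⋊ (GL_{k/2}²)_{□}` (`W = ⟨e_1,…,e_k⟩`; the index-2 square-determinant condition is the graded-Neumann
correction `2|H|² ≤ dim F_k` demanded by all three triagers), in TRANSVERSAL position
(`W' + g₂W' = 𝔽_p^n`, `(W' ∩ g₂W') + g₃W' = 𝔽_p^n`, `W' = ⟨e_{k+1},…,e_n⟩`; satisfiable iff `n ≥ 3k`).
* S1 `stub_hostGroup` (M, provable now): `H` is a subgroup of `GL_n(𝔽_p)` with `|H| ≥ p^{nk − k²/2}/16`
  (block-matrix closure; `|GL_r(𝔽_p)| ≥ 0.288 p^{r²}`).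
* S2 `stub_transversalTPP` (M, provable now): TPP IS FREE in transversal position — if `a, b, c` fix `W'`
  pointwise and `a · g₂bg₂⁻¹ · g₃cg₃⁻¹ = 1` then `a = b = c = 1` (the third factor fixes
  `(W' ∩ g₂W') + g₃W'`, then the first fixes `W' + g₂W'`).  Pure linear algebra, uniform in `p`; it uses only
  `H ≤ Fix(W')`, so it survives any reshape of the Levi part.
* S3 `stub_transversalIdentityTest` (XL, OPEN — the closer, the card's Transfer `C⁺` in its triage-sharpened form):
  at some cell `(n, k)` and along unboundedly many primes `p`, some transversal `(g₂, g₃)` admits ONE level-`k`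
  function `f = Σ_{rk M ≤ k} c_M ψ(tr(M·))` with `f(1) = 1` and `f = 0` on `H·H^{g₂}·H^{g₃} ∖ {1}`.
* S4 `stub_cellBudget` (LANDED — the lead's elementary graded budget `CellBudget`, stubs A–F of line `Sketch`,
  proposals p87876/p89272/p89717/p90134/p90736/p91913 accepted): registered here ONLY because the farm reports the
  six `Theorems/LevelGradedCohnUmansLieRankDesignsStub*.lean` modules `remote:stale … unbuilt` at write time; its
  discharge is the one-liner `stub_budgetGlue stub_levelFixedVector stub_parabolicFacts stub_orbitSpanBound
  stub_regularCount stub_centralDegreeBound` (namespace `…Theorems.LieRankDesigns`).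
PROVED HERE (no sorry): the Fourier-side translation `fourierFn_translate` (bi-invariance of `F_k`); the
conjugate-triple identity link `rankSep_of_hosts` (S2-TPP + identity test ⇒ `RankSep k H H^{g₂} H^{g₃}` as
finsets, volume `|H|³`); `fixedCellSaturation_of_hosts : S1 → S2 → S3 → FixedCellSaturation` with `c₀ = 1/4096`
(the lead's stub G, SAME statement as in `Lines/Sketch.lean`, so this line is literally a construction of the
lead's open stub); the lead's universality transfers `nearWallDesigns_of_fixedCell`,
`lieRankDesigns_of_cellBudget_of_nearWall` (copied verbatim from `Lines/Sketch.lean` v4b, credit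
prover-line-stmt-MatrixMultiplication-7614-0, because crux work files cannot be imported); and the composition
`LieRankDesigns_of : S1 → S2 → S3 → S4 → LieRankDesigns` BY NAME.

DISPROOF USED (`Cruxes/LieRankDesigns/Disproof.lean`, cdisprove v1, verdict NO KILL; no `_false_without_<H>`
theorem exists — its load-bearing clauses play that role): strict `<` (`lieRankDesigns_le_variant`,
`one_le_budget`, `two_le_volume`) honoured — the transfer proves the STRICT inequality (`hmid`); dead slices
`k = 0` / `m = 0` / `m = 1` (`not_lieRankDesigns_levelZero/rankZeroMatrices/matOne`) never instantiated (S3 asks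
`1 ≤ k ≤ n`, and S2's transversality forces `n ≥ 3k ≥ 3`); bi-invariance (`fourierFn_transl`) is exactly
`fourierFn_translate` below, used at `rankSep_of_hosts`; the walls `wall_XY/XZ/YZ`, graded Neumann
`neumann_X/Z` (`2h² − h ≤ dim F_k`), pigeonhole `card_XY_add_card_YZ_le` and isotropy
`card_XZ_add_card_quadProducts_le` (`2k < n` here) are consequences of `RankSep` and constrain only S3's
witnesses: with `h = |H| = p^{k(n−k)}|GL_{k/2}(𝔽_p)|²/2 = (p^e/2)(1 − O(1/p))` one has `2h² ≈ D_k/2`,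
`2h² ≪ |G|`, `h² + h³ ≪ |G| = p^{n²}` (`3e < n²` for `n ≥ 3k`) — all met; `tpp_of_rankSep` is produced, not
assumed (S2).  Landed sibling negatives checked against S3 (statements, not importable constraints — the modules
are unbuilt on the farm today): `SubgroupIdentityDesigns/Negative/GradedNormalizerCount`
(`|H₁||K||H₃| ≤ dim F_k` for `K ≤ H₂` normalising `H₃`: with `h² ≈ D/4` any transversal position with
`|H^{g₂} ∩ N(H)| ≥ 5` is dead — S3's `(g₂, g₃)` must be generic, NOT coordinate permutations, whose conjugated
tori normalise `H`), `StabilizerCount` / `TriangularCount` (certified-rank pre-tests), `TorusCube` (no split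
`(k+1)`-torus cube of unitriangular cosets through `1` inside `H H^{g₂} H^{g₃}`), `GradedPlancherel`.
Negatives index (`run/shared/priority/refutations.json`, 6 MatrixMultiplication entries: LevelTwoBeatsCubes,
ExactLineDesign, ExactFrameDesign, SeparableDesignsMultiplicative, …): none restated (no `S_n` level, no
frame-STPP, no product separators).
-/

set_option linter.dupNamespace false
set_option linter.unusedVariables false

noncomputable section

namespace Summit.MatrixMultiplication.MatrixMultiplication.Cruxes.LieRankDesigns.SubgroupHostsOneFunction

open scoped BigOperators
open Literature.RepresentationTheory.FiniteGroups
open Summit.MatrixMultiplication.MatrixMultiplication.Theorems.LieRankDesigns.Negative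
  (GLm Mat fourierFn RankSupp RankSep levelSet budget volume lieRankDesigns_iff)

/-! ## Vocabulary (readability only — every registered stub inlines these, tree vocabulary being `Mathlib` +
`Theorems/LieRankDesigns/Negative/Basics.lean`) -/

variable {p n : ℕ}

/-- `g` fixes `W' = ⟨e_k, …, e_{n-1}⟩` pointwise: the columns `j ≥ k` of `g` are those of the identity
(`Fix(W') = N⁻_W ⋊ GL_k = [[A, 0], [C, 1]]`, blocks `k`, `n - k`). -/
def ColFix (k : ℕ) (g : GLm p n) : Prop :=
  ∀ i j : Fin n, k ≤ (j : ℕ) → (g : Mat p n) i j = (1 : Mat p n) i j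

/-- The Levi condition: the top-left `k × k` block of `g` is block-diagonal with blocks `⌊k/2⌋`, `k - ⌊k/2⌋`. -/
def LeviBlockDiag (k : ℕ) (g : GLm p n) : Prop :=
  ∀ i j : Fin n, (i : ℕ) < k → (j : ℕ) < k → ((i : ℕ) < k / 2 ↔ k / 2 ≤ (j : ℕ)) → (g : Mat p n) i j = 0

/-- The index-2 (for `p` odd) condition: the determinant of the first diagonal block `A₁` (size `⌊k/2⌋`, padded by
the identity to an `n × n` matrix) is a square in `𝔽_p`. -/
def SquareBlockDet (k : ℕ) (g : GLm p n) : Prop :=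
  IsSquare (Matrix.det (Matrix.of fun i j : Fin n =>
    if (i : ℕ) < k / 2 ∧ (j : ℕ) < k / 2 then (g : Mat p n) i j else (1 : Mat p n) i j))

/-- The host `H = N⁻_W ⋊ (GL_{k/2} × GL_{k/2})_□` as a predicate on `GL_n(𝔽_p)`. -/
def IsHost (k : ℕ) (g : GLm p n) : Prop :=
  ColFix k g ∧ LeviBlockDiag k g ∧ SquareBlockDet k g

/-- `W' = span{e_j : j ≥ k} ≤ 𝔽_p^n`. -/
def coSpace (p n k : ℕ) : Submodule (ZMod p) (Fin n → ZMod p) :=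
  Submodule.span (ZMod p) (Set.range fun j : {j : Fin n // k ≤ (j : ℕ)} => Pi.single (j : Fin n) 1)

/-- TRANSVERSAL position of `(g₂, g₃)`: `W' + g₂W' = 𝔽_p^n` and `(W' ∩ g₂W') + g₃W' = 𝔽_p^n`. -/
def Transversal (k : ℕ) (g₂ g₃ : GLm p n) : Prop :=
  coSpace p n k ⊔ (coSpace p n k).map (Matrix.toLin' (g₂ : Mat p n)) = ⊤ ∧
    (coSpace p n k ⊓ (coSpace p n k).map (Matrix.toLin' (g₂ : Mat p n))) ⊔
      (coSpace p n k).map (Matrix.toLin' (g₃ : Mat p n)) = ⊤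

/-! ## S1 — the host is a subgroup of the wall size (size M, provable now) -/

/-- **S1 `HostGroup`.** For `p` prime and `1 ≤ k ≤ n` the host predicate `IsHost k` cuts out a SUBGROUP `H` of
`GL_n(𝔽_p)` with `|H| ≥ p^{nk − k²/2}/16`.  Proof sketch: elements are `[[diag(A₁,A₂), 0], [C, 1]]`, closed under
products (`[[A,0],[C,1]]·[[A',0],[C',1]] = [[AA',0],[CA'+C',1]]`, `det(A₁A₁') = det A₁ det A₁'`) and inverses;
`|H| = p^{k(n−k)}|GL_{⌊k/2⌋}(𝔽_p)||GL_{⌈k/2⌉}(𝔽_p)|/[𝔽_p^× : (𝔽_p^×)²]` and `|GL_r(𝔽_p)| ≥ p^{r²}∏(1 − p^{−i}) ≥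
0.288 p^{r²}`, `⌊k/2⌋² + ⌈k/2⌉² ≥ k²/2`, `0.288²/2 ≥ 1/16` hmm — use `0.288² ≥ 1/16` at `p = 2` (no halving, every unit
is a square) and `0.56²/2 ≥ 1/16` for `p ≥ 3`.  Why it might fail: it does not (counting); cost = block matrices
over `Fin n` (compare the lead's landed `stub_parabolicFacts`). -/
def HostGroup : Prop :=
  ∀ (p n k : ℕ) [Fact p.Prime], 1 ≤ k → k ≤ n →
    ∃ H : Subgroup (GLm p n), (∀ g : GLm p n, g ∈ H ↔ IsHost k g) ∧
      (p : ℝ) ^ ((n : ℝ) * k - (k : ℝ) ^ 2 / 2) / 16 ≤ Nat.card H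

/-- Registered stub S1 (statement = `HostGroup`, vocabulary inlined). -/
theorem stub_hostGroup :
    ∀ (p n k : ℕ) [Fact p.Prime], 1 ≤ k → k ≤ n →
      ∃ H : Subgroup (GLm p n),
        (∀ g : GLm p n, g ∈ H ↔
          ((∀ i j : Fin n, k ≤ (j : ℕ) → (g : Mat p n) i j = (1 : Mat p n) i j) ∧
           (∀ i j : Fin n, (i : ℕ) < k → (j : ℕ) < k → ((i : ℕ) < k / 2 ↔ k / 2 ≤ (j : ℕ)) →
              (g : Mat p n) i j = 0) ∧
           IsSquare (Matrix.det (Matrix.of fun i j : Fin n =>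
             if (i : ℕ) < k / 2 ∧ (j : ℕ) < k / 2 then (g : Mat p n) i j else (1 : Mat p n) i j)))) ∧
        (p : ℝ) ^ ((n : ℝ) * k - (k : ℝ) ^ 2 / 2) / 16 ≤ Nat.card H := by
  sorry

/-! ## S2 — TPP is free in transversal position (size M, provable now) -/

/-- **S2 `TransversalTPP`.** If `a, b, c ∈ GL_n(𝔽_p)` all fix `W' = ⟨e_j : j ≥ k⟩` pointwise (columns `j ≥ k`
standard) and `(g₂, g₃)` is transversal (`W' + g₂W' = ⊤`, `(W' ∩ g₂W') + g₃W' = ⊤`), then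
`a · g₂bg₂⁻¹ · g₃cg₃⁻¹ = 1 ⇒ a = b = c = 1`: `c' := g₃cg₃⁻¹ = (a·b')⁻¹` fixes `W' ∩ g₂W'` (both `a` and
`b' := g₂bg₂⁻¹` do) and `g₃W'`, hence everything, so `c = 1`; then `b' = a⁻¹` fixes `W' + g₂W'`, so `a = b = 1`.
This is the subgroup TPP of `(H₁, H₂, H₃) = (H, H^{g₂}, H^{g₃})` for ANY `H ≤ Fix(W')`, in element form.
Transversality is satisfiable iff `(n − 2k) + (n − k) ≥ n`, i.e. `n ≥ 3k` (inside the card's window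
`3·dim H < n² ⇔ k < 0.42n`).  Why it might fail: it does not (linear algebra over any field). -/
def TransversalTPP : Prop :=
  ∀ (p n k : ℕ) [Fact p.Prime] (g₂ g₃ : GLm p n), Transversal k g₂ g₃ →
    ∀ a b c : GLm p n, ColFix k a → ColFix k b → ColFix k c →
      a * (g₂ * b * g₂⁻¹) * (g₃ * c * g₃⁻¹) = 1 → a = 1 ∧ b = 1 ∧ c = 1

/-- Registered stub S2 (statement = `TransversalTPP`, vocabulary inlined). -/
theorem stub_transversalTPP :
    ∀ (p n k : ℕ) [Fact p.Prime] (g₂ g₃ : GLm p n),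
      (Submodule.span (ZMod p) (Set.range fun j : {j : Fin n // k ≤ (j : ℕ)} => Pi.single (j : Fin n) 1) ⊔
          (Submodule.span (ZMod p)
            (Set.range fun j : {j : Fin n // k ≤ (j : ℕ)} => Pi.single (j : Fin n) 1)).map
            (Matrix.toLin' (g₂ : Mat p n)) = ⊤ ∧
        (Submodule.span (ZMod p) (Set.range fun j : {j : Fin n // k ≤ (j : ℕ)} => Pi.single (j : Fin n) 1) ⊓
            (Submodule.span (ZMod p)
              (Set.range fun j : {j : Fin n // k ≤ (j : ℕ)} => Pi.single (j : Fin n) 1)).map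
              (Matrix.toLin' (g₂ : Mat p n))) ⊔
          (Submodule.span (ZMod p)
            (Set.range fun j : {j : Fin n // k ≤ (j : ℕ)} => Pi.single (j : Fin n) 1)).map
            (Matrix.toLin' (g₃ : Mat p n)) = ⊤) →
      ∀ a b c : GLm p n,
        (∀ i j : Fin n, k ≤ (j : ℕ) → (a : Mat p n) i j = (1 : Mat p n) i j) →
        (∀ i j : Fin n, k ≤ (j : ℕ) → (b : Mat p n) i j = (1 : Mat p n) i j) →
        (∀ i j : Fin n, k ≤ (j : ℕ) → (c : Mat p n) i j = (1 : Mat p n) i j) →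
        a * (g₂ * b * g₂⁻¹) * (g₃ * c * g₃⁻¹) = 1 → a = 1 ∧ b = 1 ∧ c = 1 := by
  sorry

/-! ## S3 — the identity test in transversal position (the closer; size XL, OPEN) -/

/-- **S3 `TransversalIdentityTest`** (hardest stub; the card's Transfer `C⁺`, triage-sharpened; the INTENDED witnesses
are GENERIC pairs `(g₂, g₃)`, the statement asks only for one transversal pair per prime): there are a cell
`(n, k)` with `1 ≤ k ≤ n` such that for unboundedly many primes `p` some TRANSVERSAL pair `(g₂, g₃)` and ONE
coefficient table `c` of Fourier rank `≤ k` give `f = Σ_M c_M ψ(tr(M·))` with `f(1) = 1` and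
`f(a · g₂bg₂⁻¹ · g₃dg₃⁻¹) = 0` whenever `a, b, d ∈ H` (the host `IsHost k`) and the product is `≠ 1` — the single
linear condition `ev_1 ∉ span{ev_s : s ∈ H H^{g₂} H^{g₃} ∖ 1}` in `F_k^*`.  Intended regime: `k` even, `n ≥ 3k`,
`p` odd (then `|H| = (p^e/2)(1 − O(1/p))`, `2|H|² ≈ dim F_k / 2`: graded Neumann met with a full slice of slack),
first labs `(6,2,p)`, `(12,4,p)`; `(g₂, g₃)` GENERIC (Lang–Weil), in particular with `|H^{gᵢ} ∩ N_G(H)| ≤ 4`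
(graded normalizer count) — coordinate permutations are transversal but DEAD (their conjugated tori normalise `H`).
Attack (card + triage): `ev`-duality splits the test into (a) pair-injectivity of `(H, H^{g₃})` and (b) the joint
middle-rank condition `rank{ev_s : s ∈ H (H^{g₂} ∖ 1) H^{g₃}} ≤ dim F_k − |H|²` (r1-2 App. B; certified-rank
pre-test `card_le_finrank_of_triangular` first), each an `H × H`-isotypic family of systems computable from the
Mackey data of `F_k|_H` (Harish-Chandra series through `P_k`, frame module `ℂ[M_{n×k}(𝔽_p)]`).  RESHAPE LICENCE:
S2 and all the glue below use only `ColFix` (i.e. `H ≤ Fix(W')`), so replacing the Levi predicate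
(`LeviBlockDiag ∧ SquareBlockDet`, i.e. `(GL_{k/2}²)_□`) in S1/S3 by any other subgroup scheme of `GL_k` of dimension
`k²/2` without normalising-torus surplus and with an index-2 correction — the triage's other survivor
`GL_{k/2}(𝔽_{p²})_□` first — is a local edit of two statements.  Why it might fail:
every subgroup triple with a genuine middle computed so far fails the identity test (S₉ proxy j009940 8/8, GL level-1
smear lemma, Borel template by `volume_le_finrank_of_le_normalizer`); the sibling seat conjectures
"`k < m` ⇒ `V ≤ dim F_k` for subgroup identity designs", which would kill S3 (and crux #6) outright.
[cite: CohnUmans2003 §2; BlasiakCohnGrochowPrattUmans2023 Thm 3.6; BlasiakCohnGrochowPrattUmans2024 Def 2.1/Thm 2.2;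
GurevichHowe2017] -/
def TransversalIdentityTest : Prop :=
  ∃ n k : ℕ, 1 ≤ k ∧ k ≤ n ∧ ∀ p₀ : ℕ, ∃ (p : ℕ) (_ : Fact p.Prime), p₀ ≤ p ∧
    ∃ g₂ g₃ : GLm p n, Transversal k g₂ g₃ ∧
      ∃ c : Mat p n → ℂ, RankSupp k c ∧ fourierFn c 1 = 1 ∧
        ∀ a b d : GLm p n, IsHost k a → IsHost k b → IsHost k d →
          a * (g₂ * b * g₂⁻¹) * (g₃ * d * g₃⁻¹) ≠ 1 → fourierFn c (a * (g₂ * b * g₂⁻¹) * (g₃ * d * g₃⁻¹)) = 0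

/-- Registered stub S3 (statement = `TransversalIdentityTest`, vocabulary inlined down to `Negative/Basics`). -/
theorem stub_transversalIdentityTest :
    ∃ n k : ℕ, 1 ≤ k ∧ k ≤ n ∧ ∀ p₀ : ℕ, ∃ (p : ℕ) (_ : Fact p.Prime), p₀ ≤ p ∧
      ∃ g₂ g₃ : GLm p n,
        (Submodule.span (ZMod p) (Set.range fun j : {j : Fin n // k ≤ (j : ℕ)} => Pi.single (j : Fin n) 1) ⊔
            (Submodule.span (ZMod p)
              (Set.range fun j : {j : Fin n // k ≤ (j : ℕ)} => Pi.single (j : Fin n) 1)).map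
              (Matrix.toLin' (g₂ : Mat p n)) = ⊤ ∧
          (Submodule.span (ZMod p) (Set.range fun j : {j : Fin n // k ≤ (j : ℕ)} => Pi.single (j : Fin n) 1) ⊓
              (Submodule.span (ZMod p)
                (Set.range fun j : {j : Fin n // k ≤ (j : ℕ)} => Pi.single (j : Fin n) 1)).map
                (Matrix.toLin' (g₂ : Mat p n))) ⊔
            (Submodule.span (ZMod p)
              (Set.range fun j : {j : Fin n // k ≤ (j : ℕ)} => Pi.single (j : Fin n) 1)).map
              (Matrix.toLin' (g₃ : Mat p n)) = ⊤) ∧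
        ∃ c : Mat p n → ℂ, RankSupp k c ∧ fourierFn c 1 = 1 ∧
          ∀ a b d : GLm p n,
            ((∀ i j : Fin n, k ≤ (j : ℕ) → (a : Mat p n) i j = (1 : Mat p n) i j) ∧
             (∀ i j : Fin n, (i : ℕ) < k → (j : ℕ) < k → ((i : ℕ) < k / 2 ↔ k / 2 ≤ (j : ℕ)) →
                (a : Mat p n) i j = 0) ∧
             IsSquare (Matrix.det (Matrix.of fun i j : Fin n =>
               if (i : ℕ) < k / 2 ∧ (j : ℕ) < k / 2 then (a : Mat p n) i j else (1 : Mat p n) i j))) →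
            ((∀ i j : Fin n, k ≤ (j : ℕ) → (b : Mat p n) i j = (1 : Mat p n) i j) ∧
             (∀ i j : Fin n, (i : ℕ) < k → (j : ℕ) < k → ((i : ℕ) < k / 2 ↔ k / 2 ≤ (j : ℕ)) →
                (b : Mat p n) i j = 0) ∧
             IsSquare (Matrix.det (Matrix.of fun i j : Fin n =>
               if (i : ℕ) < k / 2 ∧ (j : ℕ) < k / 2 then (b : Mat p n) i j else (1 : Mat p n) i j))) →
            ((∀ i j : Fin n, k ≤ (j : ℕ) → (d : Mat p n) i j = (1 : Mat p n) i j) ∧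
             (∀ i j : Fin n, (i : ℕ) < k → (j : ℕ) < k → ((i : ℕ) < k / 2 ↔ k / 2 ≤ (j : ℕ)) →
                (d : Mat p n) i j = 0) ∧
             IsSquare (Matrix.det (Matrix.of fun i j : Fin n =>
               if (i : ℕ) < k / 2 ∧ (j : ℕ) < k / 2 then (d : Mat p n) i j else (1 : Mat p n) i j))) →
            a * (g₂ * b * g₂⁻¹) * (g₃ * d * g₃⁻¹) ≠ 1 →
              fourierFn c (a * (g₂ * b * g₂⁻¹) * (g₃ * d * g₃⁻¹)) = 0 := by
  sorry

/-! ## S4 — the elementary graded budget of a fixed cell (LANDED; registered only because its modules are unbuilt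
on the farm today) -/

/-- **`CellBudget`** (the lead's stub F, line `Sketch`; identical statement): for `p` prime, `1 ≤ k ≤ m`, `s ≥ 2`,
`budget p m k s · (p−1)^{(s−2)/2} ≤ 2^{m(s−1)} · p^{(mk − k²/2)s}` — level pinning with the centre's slack, which is
all the fixed-cell transfer needs.  LANDED (p87876, p89272, p89717, p90134, p90736, p91913, all accepted):
`= stub_budgetGlue stub_levelFixedVector stub_parabolicFacts stub_orbitSpanBound stub_regularCount
stub_centralDegreeBound` in `Summit.MatrixMultiplication.MatrixMultiplication.Theorems.LieRankDesigns`
(modules `Theorems/LevelGradedCohnUmansLieRankDesignsStub{BudgetGlue,LevelFixedVector,ParabolicFacts,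
OrbitSpanBound,RegularCount,CentralDegreeBound}.lean`).  Why it might fail: it does not (proved). -/
def CellBudget : Prop :=
  ∀ (p m k : ℕ) [Fact p.Prime], 1 ≤ k → k ≤ m → ∀ s : ℝ, 2 ≤ s →
    budget p m k s * ((p : ℝ) - 1) ^ ((s - 2) / 2) ≤
      2 ^ ((m : ℝ) * (s - 1)) * (p : ℝ) ^ (((m : ℝ) * k - (k : ℝ) ^ 2 / 2) * s)

/-- Registered stub S4 (statement = `CellBudget`; LANDED — discharge by importing the six `Stub*` modules above and
`exact stub_budgetGlue stub_levelFixedVector stub_parabolicFacts stub_orbitSpanBound stub_regularCount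
stub_centralDegreeBound`). -/
theorem stub_cellBudget :
    ∀ (p m k : ℕ) [Fact p.Prime], 1 ≤ k → k ≤ m → ∀ s : ℝ, 2 ≤ s →
      budget p m k s * ((p : ℝ) - 1) ^ ((s - 2) / 2) ≤
        2 ^ ((m : ℝ) * (s - 1)) * (p : ℝ) ^ (((m : ℝ) * k - (k : ℝ) ^ 2 / 2) * s) := by
  sorry

/-! ### Registered-stub aliases (hypothesis heads of `LieRankDesigns_of` are matched BY NAME) -/
namespace Registered

/-- Statement of registered stub S1 (provable now). -/
abbrev stub_hostGroup : Prop := HostGroup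
/-- Statement of registered stub S2 (provable now). -/
abbrev stub_transversalTPP : Prop := TransversalTPP
/-- Statement of registered stub S3 (open; the closer). -/
abbrev stub_transversalIdentityTest : Prop := TransversalIdentityTest
/-- Statement of registered stub S4 (landed). -/
abbrev stub_cellBudget : Prop := CellBudget

end Registered

/-! ## The lead's design targets (SAME statements as `Lines/Sketch.lean`, so that `fixedCellSaturation_of_hosts`
is literally a proof of the lead's open stub G from S1–S3) -/

/-- **G `FixedCellSaturation`** (line `Sketch`, stub G): one cell, constant factor, unboundedly many primes. -/
def FixedCellSaturation : Prop :=
  ∃ m k : ℕ, 1 ≤ k ∧ k ≤ m ∧ ∃ c₀ : ℝ, 0 < c₀ ∧ ∀ p₀ : ℕ, ∃ (p : ℕ) (_ : Fact p.Prime), p₀ ≤ p ∧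
    ∃ X Y Z : Finset (GLm p m), RankSep k X Y Z ∧
      c₀ * (p : ℝ) ^ (3 * (m : ℝ) * k - 3 / 2 * (k : ℝ) ^ 2) ≤ volume X Y Z

/-- **G'' `NearWallDesigns`** (line `Sketch`, stub G''): loss `p^δ`, every `δ`, some cell. -/
def NearWallDesigns : Prop :=
  ∀ δ : ℝ, 0 < δ → ∃ m k : ℕ, 1 ≤ k ∧ k ≤ m ∧ ∀ p₀ : ℕ, ∃ (p : ℕ) (_ : Fact p.Prime), p₀ ≤ p ∧
    ∃ X Y Z : Finset (GLm p m), RankSep k X Y Z ∧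
      (p : ℝ) ^ (3 * (m : ℝ) * k - 3 / 2 * (k : ℝ) ^ 2 - δ) ≤ volume X Y Z

/-! ## Glue 1 (proved): bi-invariance of `F_k` on the Fourier side -/

/-- **Translation of a rank-`≤ k` test**: for `a, b ∈ GL_n(𝔽_p)` the function `g ↦ f(a g b)` is again of Fourier
rank `≤ k` (coefficients `c'_{M'} = c_{b⁻¹ M' a⁻¹}`; `tr(M a g b) = tr((b M a) g)`, `rk(b M a) = rk M`).  Same proof as
the landed `Theorems.rankTest_translate` (module unbuilt on the farm today, hence re-proved). [folklore] -/
theorem fourierFn_translate [Fact p.Prime] {k : ℕ} (c : Mat p n → ℂ) (hc : RankSupp k c) (a b : GLm p n) :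
    ∃ c' : Mat p n → ℂ, RankSupp k c' ∧ ∀ g : GLm p n, fourierFn c' g = fourierFn c (a * g * b) := by
  refine ⟨fun M' => c (((b⁻¹ : GLm p n) : Mat p n) * M' * ((a⁻¹ : GLm p n) : Mat p n)),
    fun M' hM' => hc _ ?_, fun g => ?_⟩
  · rwa [Matrix.rank_mul_eq_left_of_isUnit_det _ _ (Matrix.isUnits_det_units a⁻¹),
      Matrix.rank_mul_eq_right_of_isUnit_det _ _ (Matrix.isUnits_det_units b⁻¹)]
  · unfold fourierFn
    symm
    refine Fintype.sum_equiv ((Units.mulLeft b).trans (Units.mulRight a)) _ _ (fun M => ?_)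
    have hM : ((b⁻¹ : GLm p n) : Mat p n) * ((b : Mat p n) * M * (a : Mat p n)) * ((a⁻¹ : GLm p n) : Mat p n)
        = M := by
      simp only [Matrix.mul_assoc, Units.mul_inv, Matrix.mul_one, Units.inv_mul_cancel_left]
    simp only [Equiv.trans_apply, Units.mulLeft_apply, Units.mulRight_apply, hM]
    congr 2
    rw [Units.val_mul, Units.val_mul,
      show M * ((a : Mat p n) * (g : Mat p n) * (b : Mat p n)) = (M * (a : Mat p n) * (g : Mat p n)) * (b : Mat p n)
        by simp only [Matrix.mul_assoc],
      Matrix.trace_mul_comm, ← Matrix.mul_assoc, ← Matrix.mul_assoc]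

/-! ## Glue 2 (proved): the conjugate-triple identity link — S2-TPP + one identity test ⇒ `RankSep` -/

/-- **One function separates a TPP conjugate triple.**  `H ≤ GL_n(𝔽_p)` a subgroup, `g₂, g₃` such that
`a · g₂bg₂⁻¹ · g₃dg₃⁻¹ = 1 ⇒ a = b = d = 1` on `H³` (TPP of `(H, H^{g₂}, H^{g₃})`), and ONE rank-`≤ k` table `c`
with `f_c(1) = 1`, `f_c = 0` on the other triple products: then the finsets `X = H`, `Y = g₂Hg₂⁻¹`, `Z = g₃Hg₃⁻¹`
are `RankSep k` — the target `(x₀, z₀)` is read by the translate `g ↦ f_c(x₀ g z₀⁻¹)` (`fourierFn_translate`),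
whose argument on a quadruple regroups as `(x₀x⁻¹) · g₂(b₁b₂⁻¹)g₂⁻¹ · g₃(d₁d₀⁻¹)g₃⁻¹`. [folklore; = route item
SubgroupIdentityLink for conjugate triples] -/
theorem rankSep_of_hosts [Fact p.Prime] {k : ℕ} (H : Subgroup (GLm p n)) (g₂ g₃ : GLm p n)
    (htpp : ∀ a b d : GLm p n, a ∈ H → b ∈ H → d ∈ H →
      a * (g₂ * b * g₂⁻¹) * (g₃ * d * g₃⁻¹) = 1 → a = 1 ∧ b = 1 ∧ d = 1)
    (c : Mat p n → ℂ) (hc : RankSupp k c) (h1 : fourierFn c 1 = 1)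
    (h0 : ∀ a b d : GLm p n, a ∈ H → b ∈ H → d ∈ H →
      a * (g₂ * b * g₂⁻¹) * (g₃ * d * g₃⁻¹) ≠ 1 → fourierFn c (a * (g₂ * b * g₂⁻¹) * (g₃ * d * g₃⁻¹)) = 0)
    (X : Finset (GLm p n)) (hX : ∀ x, x ∈ X ↔ x ∈ H) :
    RankSep k X (X.image fun x => g₂ * x * g₂⁻¹) (X.image fun x => g₃ * x * g₃⁻¹) := by
  classical
  intro x₀ hx₀ z₀ hz₀
  rw [Finset.mem_image] at hz₀
  obtain ⟨d₀, hd₀, rfl⟩ := hz₀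
  obtain ⟨c', hc', hsum⟩ := fourierFn_translate c hc x₀ (g₃ * d₀ * g₃⁻¹)⁻¹
  refine ⟨c', hc', ?_⟩
  intro x hx y hy y' hy' z hz
  rw [Finset.mem_image] at hy hy' hz
  obtain ⟨b₁, hb₁, rfl⟩ := hy
  obtain ⟨b₂, hb₂, rfl⟩ := hy'
  obtain ⟨d₁, hd₁, rfl⟩ := hz
  rw [hX] at hx₀ hx hb₁ hb₂ hd₀ hd₁
  rw [hsum]
  have hregroup : x₀ * (x⁻¹ * (g₂ * b₁ * g₂⁻¹) * (g₂ * b₂ * g₂⁻¹)⁻¹ * (g₃ * d₁ * g₃⁻¹)) * (g₃ * d₀ * g₃⁻¹)⁻¹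
      = (x₀ * x⁻¹) * (g₂ * (b₁ * b₂⁻¹) * g₂⁻¹) * (g₃ * (d₁ * d₀⁻¹) * g₃⁻¹) := by
    group
  rw [hregroup]
  have ha : x₀ * x⁻¹ ∈ H := H.mul_mem hx₀ (H.inv_mem hx)
  have hb : b₁ * b₂⁻¹ ∈ H := H.mul_mem hb₁ (H.inv_mem hb₂)
  have hd : d₁ * d₀⁻¹ ∈ H := H.mul_mem hd₁ (H.inv_mem hd₀)
  by_cases hone : (x₀ * x⁻¹) * (g₂ * (b₁ * b₂⁻¹) * g₂⁻¹) * (g₃ * (d₁ * d₀⁻¹) * g₃⁻¹) = 1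
  · obtain ⟨e1, e2, e3⟩ := htpp _ _ _ ha hb hd hone
    rw [hone, h1, if_pos ⟨(mul_inv_eq_one.mp e1).symm, by rw [mul_inv_eq_one.mp e2],
      by rw [mul_inv_eq_one.mp e3]⟩]
  · rw [h0 _ _ _ ha hb hd hone, if_neg]
    rintro ⟨rfl, e2, e3⟩
    have hinj₂ : Function.Injective fun x : GLm p n => g₂ * x * g₂⁻¹ := fun u v huv => by simpa using huv
    have hinj₃ : Function.Injective fun x : GLm p n => g₃ * x * g₃⁻¹ := fun u v huv => by simpa using huv
    have e2' : b₁ = b₂ := hinj₂ e2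
    have e3' : d₁ = d₀ := hinj₃ e3
    subst e2' e3'
    exact hone (by simp only [mul_inv_cancel, mul_one])

/-! ## Glue 3 (proved): S1 + S2 + S3 ⇒ the lead's stub G (fixed-cell wall saturation, `c₀ = 1/4096`) -/

/-- **The hosts saturate the wall of their cell up to the constant `4096`**: `V = |H|³ ≥ (p^e/16)³`. -/
theorem fixedCellSaturation_of_hosts (hS1 : HostGroup) (hS2 : TransversalTPP) (hS3 : TransversalIdentityTest) :
    FixedCellSaturation := by
  classical
  obtain ⟨n, k, hk, hkn, hall⟩ := hS3
  refine ⟨n, k, hk, hkn, 1 / 4096, by norm_num, fun p₀ => ?_⟩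
  obtain ⟨p, hprime, hp₀p, g₂, g₃, htrans, c, hc, h1, h0⟩ := hall p₀
  obtain ⟨H, hH, hsize⟩ := hS1 p n k hk hkn
  refine ⟨p, hprime, hp₀p, ?_⟩
  -- TPP on `H` from transversality (S2; the host fixes `W'` pointwise)
  have htpp : ∀ a b d : GLm p n, a ∈ H → b ∈ H → d ∈ H →
      a * (g₂ * b * g₂⁻¹) * (g₃ * d * g₃⁻¹) = 1 → a = 1 ∧ b = 1 ∧ d = 1 := fun a b d ha hb hd =>
    hS2 p n k g₂ g₃ htrans a b d ((hH a).1 ha).1 ((hH b).1 hb).1 ((hH d).1 hd).1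
  have h0' : ∀ a b d : GLm p n, a ∈ H → b ∈ H → d ∈ H →
      a * (g₂ * b * g₂⁻¹) * (g₃ * d * g₃⁻¹) ≠ 1 → fourierFn c (a * (g₂ * b * g₂⁻¹) * (g₃ * d * g₃⁻¹)) = 0 :=
    fun a b d ha hb hd => h0 a b d ((hH a).1 ha) ((hH b).1 hb) ((hH d).1 hd)
  set X : Finset (GLm p n) := Finset.univ.filter (· ∈ H) with hXdef
  have hX : ∀ x, x ∈ X ↔ x ∈ H := fun x => by simp [hXdef]
  refine ⟨X, X.image fun x => g₂ * x * g₂⁻¹, X.image fun x => g₃ * x * g₃⁻¹,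
    rankSep_of_hosts H g₂ g₃ htpp c hc h1 h0' X hX, ?_⟩
  -- volume `= |H|³ ≥ (p^e/16)³ = p^{3e}/4096`
  have hcardX : X.card = Nat.card H :=
    (Nat.subtype_card (p := (· ∈ H)) X (fun x => by simp [hXdef])).symm
  have hinj₂ : Function.Injective fun x : GLm p n => g₂ * x * g₂⁻¹ := fun u v huv => by simpa using huv
  have hinj₃ : Function.Injective fun x : GLm p n => g₃ * x * g₃⁻¹ := fun u v huv => by simpa using huv
  have hcardY : (X.image fun x => g₂ * x * g₂⁻¹).card = Nat.card H := by
    rw [Finset.card_image_of_injective X hinj₂, hcardX]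
  have hcardZ : (X.image fun x => g₃ * x * g₃⁻¹).card = Nat.card H := by
    rw [Finset.card_image_of_injective X hinj₃, hcardX]
  have hvol : volume X (X.image fun x => g₂ * x * g₂⁻¹) (X.image fun x => g₃ * x * g₃⁻¹)
      = (Nat.card H : ℝ) ^ 3 := by
    unfold volume
    rw [hcardX, hcardY, hcardZ]
    push_cast
    ring
  rw [hvol]
  have hp0 : (0 : ℝ) < p := by exact_mod_cast hprime.out.pos
  set e : ℝ := (n : ℝ) * k - (k : ℝ) ^ 2 / 2 with he
  have hpe : 0 ≤ (p : ℝ) ^ e / 16 := by positivity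
  have hcube : ((p : ℝ) ^ e / 16) ^ 3 ≤ (Nat.card H : ℝ) ^ 3 := by
    gcongr
  have hexp : (p : ℝ) ^ (3 * (n : ℝ) * k - 3 / 2 * (k : ℝ) ^ 2) = ((p : ℝ) ^ e) ^ 3 := by
    rw [show (3 * (n : ℝ) * k - 3 / 2 * (k : ℝ) ^ 2) = e * 3 by rw [he]; ring, Real.rpow_mul hp0.le]
    norm_num
  calc 1 / 4096 * (p : ℝ) ^ (3 * (n : ℝ) * k - 3 / 2 * (k : ℝ) ^ 2)
      = ((p : ℝ) ^ e / 16) ^ 3 := by rw [hexp]; ring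
    _ ≤ (Nat.card H : ℝ) ^ 3 := hcube


/-! ## Glue 4 (the lead's universality transfers, copied verbatim from `Lines/Sketch.lean` v4b —
credit prover-line-stmt-MatrixMultiplication-7614-0; crux work files cannot be imported) -/

/-- **The unconditional transfer from near-wall designs** (G''): with `s = 2+ε`, `δ := 3ε/(8s)` and
`e = mk - k²/2`, `CellBudget` gives `budget ≤ 2^{m(s-1)} p^{es} (p-1)^{-ε/2} ≤ 2^{m(s-1)+ε/2} p^{es-ε/2}` while
`V^{s/3} ≥ p^{es - ε/8}`; any prime with `p^{3ε/8} > 2^{m(s-1)+ε/2}` works. -/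
theorem lieRankDesigns_of_cellBudget_of_nearWall (hB : CellBudget) (hS : NearWallDesigns) :
    (∀ ε : ℝ, 0 < ε → ∃ (p : ℕ) (_ : Fact p.Prime) (m k : ℕ) (X Y Z : Finset (GLm p m)),
      RankSep k X Y Z ∧ budget p m k (2 + ε) < volume X Y Z ^ ((2 + ε) / 3)) := by
  intro ε hε
  set s : ℝ := 2 + ε with hs_def
  have hs2 : 2 ≤ s := by rw [hs_def]; linarith
  have hs0 : 0 < s := by linarith
  -- loss rate δ := 3ε/(8s), so that δ s / 3 = ε / 8
  set δ : ℝ := 3 * ε / (8 * s) with hδ_def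
  have hδ : 0 < δ := by rw [hδ_def]; positivity
  obtain ⟨m, k, hk, hkm, hall⟩ := hS δ hδ
  -- constant to beat: K := 2^{m(s-1) + ε/2}; need p^{3ε/8} > K
  set K : ℝ := 2 ^ ((m : ℝ) * (s - 1) + ε / 2) with hK_def
  have hK : 0 < K := by rw [hK_def]; positivity
  have hexp0 : 0 < 3 * ε / 8 := by positivity
  obtain ⟨N, hN⟩ := exists_nat_gt (K ^ (1 / (3 * ε / 8)) + 2)
  obtain ⟨p, hprime, hNp, X, Y, Z, hsep, hvol⟩ := hall N
  refine ⟨p, hprime, m, k, X, Y, Z, hsep, ?_⟩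
  have hp2 : 2 ≤ p := hprime.out.two_le
  have hpR : (2 : ℝ) ≤ p := by exact_mod_cast hp2
  have hp0 : (0 : ℝ) < p := by linarith
  have hq0 : (0 : ℝ) < (p : ℝ) - 1 := by linarith
  have hNR : (N : ℝ) ≤ p := by exact_mod_cast hNp
  have hKp : K < (p : ℝ) ^ (3 * ε / 8) := by
    have h1 : K ^ (1 / (3 * ε / 8)) < p := by linarith
    have h2 : (K ^ (1 / (3 * ε / 8))) ^ (3 * ε / 8) < (p : ℝ) ^ (3 * ε / 8) :=
      Real.rpow_lt_rpow (by positivity) h1 hexp0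
    have h3 : (K ^ (1 / (3 * ε / 8))) ^ (3 * ε / 8) = K := by
      rw [← Real.rpow_mul hK.le]
      have : (1 / (3 * ε / 8)) * (3 * ε / 8) = 1 := by field_simp
      rw [this, Real.rpow_one]
    rwa [h3] at h2
  -- budget side
  set e : ℝ := (m : ℝ) * k - (k : ℝ) ^ 2 / 2 with he_def
  have hbud := hB p m k hk hkm s hs2
  have hexp : (s - 2) / 2 = ε / 2 := by rw [hs_def]; ring
  rw [hexp] at hbud
  have hqpow : 0 < ((p : ℝ) - 1) ^ (ε / 2) := Real.rpow_pos_of_pos hq0 _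
  have hbud' : budget p m k s ≤ 2 ^ ((m : ℝ) * (s - 1)) * (p : ℝ) ^ (e * s) / ((p : ℝ) - 1) ^ (ε / 2) := by
    rw [le_div_iff₀ hqpow]; exact hbud
  -- (p-1)^{ε/2} ≥ p^{ε/2} / 2^{ε/2}
  have hhalf : (p : ℝ) / 2 ≤ (p : ℝ) - 1 := by linarith
  have hq1 : (p : ℝ) ^ (ε / 2) / 2 ^ (ε / 2) ≤ ((p : ℝ) - 1) ^ (ε / 2) := by
    rw [← Real.div_rpow hp0.le (by norm_num : (0:ℝ) ≤ 2)]
    exact Real.rpow_le_rpow (by positivity) hhalf (by positivity)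
  have hpe2 : 0 < (p : ℝ) ^ (ε / 2) / 2 ^ (ε / 2) := by positivity
  have hbud'' : budget p m k s ≤ K * (p : ℝ) ^ (e * s - ε / 2) := by
    calc budget p m k s ≤ 2 ^ ((m : ℝ) * (s - 1)) * (p : ℝ) ^ (e * s) / ((p : ℝ) - 1) ^ (ε / 2) := hbud'
      _ ≤ 2 ^ ((m : ℝ) * (s - 1)) * (p : ℝ) ^ (e * s) / ((p : ℝ) ^ (ε / 2) / 2 ^ (ε / 2)) :=
          div_le_div_of_nonneg_left (by positivity) hpe2 hq1
      _ = K * (p : ℝ) ^ (e * s - ε / 2) := by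
          rw [hK_def, Real.rpow_add (by norm_num : (0:ℝ) < 2), Real.rpow_sub hp0]
          field_simp
  -- volume side: V^{s/3} ≥ p^{es - ε/8}
  have hV3 : 3 * (m : ℝ) * k - 3 / 2 * (k : ℝ) ^ 2 - δ = 3 * e - δ := by rw [he_def]; ring
  rw [hV3] at hvol
  have hV0 : 0 ≤ volume X Y Z := by unfold volume; positivity
  have hlow : ((p : ℝ) ^ (3 * e - δ)) ^ (s / 3) ≤ volume X Y Z ^ (s / 3) :=
    Real.rpow_le_rpow (by positivity) hvol (by positivity)
  have hδs : (3 * e - δ) * (s / 3) = e * s - ε / 8 := by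
    rw [hδ_def]; field_simp
  have hlow' : ((p : ℝ) ^ (3 * e - δ)) ^ (s / 3) = (p : ℝ) ^ (e * s - ε / 8) := by
    rw [← Real.rpow_mul hp0.le, hδs]
  -- compare: K p^{es - ε/2} < p^{3ε/8} p^{es - ε/2} = p^{es - ε/8}
  have hmid : K * (p : ℝ) ^ (e * s - ε / 2) < (p : ℝ) ^ (e * s - ε / 8) := by
    have hpos : 0 < (p : ℝ) ^ (e * s - ε / 2) := Real.rpow_pos_of_pos hp0 _
    calc K * (p : ℝ) ^ (e * s - ε / 2)
        < (p : ℝ) ^ (3 * ε / 8) * (p : ℝ) ^ (e * s - ε / 2) := mul_lt_mul_of_pos_right hKp hpos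
      _ = (p : ℝ) ^ (e * s - ε / 8) := by
          rw [← Real.rpow_add hp0]; congr 1; ring
  have hdiv : (2 + ε) / 3 = s / 3 := by rw [hs_def]
  rw [hdiv]
  calc budget p m k s ≤ K * (p : ℝ) ^ (e * s - ε / 2) := hbud''
    _ < (p : ℝ) ^ (e * s - ε / 8) := hmid
    _ = ((p : ℝ) ^ (3 * e - δ)) ^ (s / 3) := hlow'.symm
    _ ≤ volume X Y Z ^ (s / 3) := hlow

/-- **G ⇒ G''** (same cell; `c₀ ≥ p^{-δ}` for `p` large). -/
theorem nearWallDesigns_of_fixedCell (hG : FixedCellSaturation) : NearWallDesigns := by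
  intro δ hδ
  obtain ⟨m, k, hk, hkm, c₀, hc₀, hall⟩ := hG
  refine ⟨m, k, hk, hkm, fun p₀ => ?_⟩
  obtain ⟨N, hN⟩ := exists_nat_gt ((1 / c₀) ^ (1 / δ) + p₀ + 1)
  obtain ⟨p, hprime, hNp, X, Y, Z, hsep, hvol⟩ := hall N
  have hNR : (N : ℝ) ≤ p := by exact_mod_cast hNp
  have hpos1 : (0:ℝ) ≤ (1 / c₀) ^ (1 / δ) := by positivity
  have hp0 : (0 : ℝ) < p := by
    have : (0:ℝ) ≤ (p₀ : ℝ) := by positivity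
    linarith
  have hp₀p : p₀ ≤ p := by
    have : (p₀ : ℝ) ≤ p := by linarith
    exact_mod_cast this
  refine ⟨p, hprime, hp₀p, X, Y, Z, hsep, le_trans ?_ hvol⟩
  have h1 : (1 / c₀) ^ (1 / δ) < p := by
    have : (0:ℝ) ≤ (p₀ : ℝ) := by positivity
    linarith
  have h2 : 1 / c₀ < (p : ℝ) ^ δ := by
    have h := Real.rpow_lt_rpow (by positivity) h1 hδ
    rwa [← Real.rpow_mul (by positivity), show (1 / δ) * δ = 1 by field_simp, Real.rpow_one] at h
  have h3 : 1 < c₀ * (p : ℝ) ^ δ := by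
    rw [div_lt_iff₀ hc₀] at h2; linarith
  have hsplit : (p : ℝ) ^ (3 * (m : ℝ) * k - 3 / 2 * (k : ℝ) ^ 2 - δ) * (p : ℝ) ^ δ =
      (p : ℝ) ^ (3 * (m : ℝ) * k - 3 / 2 * (k : ℝ) ^ 2) := by
    rw [← Real.rpow_add hp0]; congr 1; ring
  have hq : 0 < (p : ℝ) ^ (3 * (m : ℝ) * k - 3 / 2 * (k : ℝ) ^ 2 - δ) := Real.rpow_pos_of_pos hp0 _
  calc (p : ℝ) ^ (3 * (m : ℝ) * k - 3 / 2 * (k : ℝ) ^ 2 - δ)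
      = (p : ℝ) ^ (3 * (m : ℝ) * k - 3 / 2 * (k : ℝ) ^ 2 - δ) * 1 := by ring
    _ ≤ (p : ℝ) ^ (3 * (m : ℝ) * k - 3 / 2 * (k : ℝ) ^ 2 - δ) * (c₀ * (p : ℝ) ^ δ) :=
        mul_le_mul_of_nonneg_left h3.le hq.le
    _ = c₀ * (p : ℝ) ^ (3 * (m : ℝ) * k - 3 / 2 * (k : ℝ) ^ 2) := by rw [← hsplit]; ring

/-! ## The composition (proved): S1 → S2 → S3 → S4 → crux, BY NAME -/

/-- **THE SKELETON closes the crux modulo the registered stubs, BY NAME**: the hosts give the lead's stub G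
(`fixedCellSaturation_of_hosts`), G gives G'' (`nearWallDesigns_of_fixedCell`), and G'' with the landed cell budget
S4 gives the crux (`lieRankDesigns_of_cellBudget_of_nearWall`, strict inequality). -/
theorem LieRankDesigns_of (h₁ : Registered.stub_hostGroup) (h₂ : Registered.stub_transversalTPP)
    (h₃ : Registered.stub_transversalIdentityTest) (h₄ : Registered.stub_cellBudget) :
    Summit.MatrixMultiplication.MatrixMultiplication.Theses.LevelGradedCohnUmans.LieRankDesigns :=
  lieRankDesigns_iff.2
    (lieRankDesigns_of_cellBudget_of_nearWall h₄
      (nearWallDesigns_of_fixedCell (fixedCellSaturation_of_hosts h₁ h₂ h₃)))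

/-- How the closed proof is obtained once S1–S3 land (S4 is landed). -/
example : Summit.MatrixMultiplication.MatrixMultiplication.Theses.LevelGradedCohnUmans.LieRankDesigns :=
  LieRankDesigns_of stub_hostGroup stub_transversalTPP stub_transversalIdentityTest stub_cellBudget

/-- The line also hands the lead's picked line `Sketch` its open stub G directly. -/
example (h₁ : Registered.stub_hostGroup) (h₂ : Registered.stub_transversalTPP)
    (h₃ : Registered.stub_transversalIdentityTest) : FixedCellSaturation :=
  fixedCellSaturation_of_hosts h₁ h₂ h₃

end Summit.MatrixMultiplication.MatrixMultiplication.Cruxes.LieRankDesigns.SubgroupHostsOneFunction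

end
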